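import Summits.CriticalPhenomena.PercolationContinuityZ3.Theorems.PercNearOneGluingNoHeavyLowerTailSunflowerAndrasfaiMerging
import HarnessLib

/-!
# `NoHeavyLowerTail` (crux stmt-CriticalPhenomena-4575), abstract sunflower cubic: the ANDRÁSFAI GRAPHS ARE A-SAFE, part 4a — the base case (Harris), recolouring a run, and the drop in the number of colour changes

Support file (seat `prim-ineq-prove-1` gen 42; `--supports stmt-CriticalPhenomena-4575`).  No `sorry`, no named facts, standard axioms.
Memo: run/shared/lean/prim/prim-ineq-prove-1/FINDING-BLOWUP-prove1-g42.md §7 (the theorem and its proof).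

THE PROGRAMME (files `…SunflowerAndrasfai*`).  THEOREM (memo §7; `Arc.arcGraph_safe` in `…SunflowerAndrasfaiSafe`): for every `k`
the graph core of the Andrásfai graph (`arcGraph k` on `Fin (3k+2)`: adjacent iff in no common arc of `k+1` consecutive points) is
safe for every product measure — conjecture (And) of `…SunflowerAndrasfai`; hence (…SunflowerBlowup, …BlowupHom) so is the core
of every blow-up of an Andrásfai graph and of every maximal triangle-free graph homomorphic to one.  PROOF: polarisation
(`safe_arcGraph_of_colouring_ineq`, part 1b) reduces safety to `∏_j Λ(C_j) ≤ Λ(∅)^(K-1)` for colourings of the arc-starts; this is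
proved by induction on the number of colour changes (part 4): one of two adjacent LIGHT runs `X`, `Y` (`|X|+|Y| ≤ 2k+1`, `|Y| ≤ k`,
part 2b) is recoloured with the other's colour, which does not decrease the product by FACT 1/2 (part 2a) and the INTERVAL MERGING
LEMMA `w(X)·w(Y) ≤ Λ(∅)·z(X,Y)` (part 3: an explicit weight-preserving injection `Φ : W_X × W_Y → A × Z_{XY}`).

THIS FILE.  `lam_mul_le` (Harris, from `famIn_two_le`), `lam_univ_le_one`, `prod_le_prod_of_pair`, the base case
`colouring_ineq_two` (at most two colours), `two_colours_of_not_three`; the recoloured colouring `recol c X j`, its classes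
`cls_recol`, and `card_changes_recol_lt` (recolouring the run after a change, to the colour of the next run or of the change itself,
strictly decreases the number of colour changes).
-/

noncomputable section

namespace Summit.CriticalPhenomena.PercolationContinuityZ3.Theorems.SunflowerPartition

namespace SafeCalc

open Finset
open TwoGenCore (wmiss)

namespace Arc

variable {k : ℕ}

/-! ## The colouring inequality: base case, the recolouring step, and the induction on colour changes -/

section Main

variable (p : Fin (3 * k + 2) → unitInterval)

/-- Harris for two disjoint sets of starts: `Λ C · Λ D ≤ Λ ∅`. [tree: `famIn_two_le`] -/
theorem lam_mul_le {C D : Finset (Fin (3 * k + 2))} (h : Disjoint C D) : lam p C * lam p D ≤ lam p ∅ := by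
  classical
  rw [← famIn_coarcs_eq_lam, ← famIn_coarcs_eq_lam, ← famIn_coarcs_empty]
  refine famIn_two_le p univ (fun C _ => subset_univ C) ?_
  rw [Finset.disjoint_left]
  intro E hE hE'
  obtain ⟨t, ht, rfl⟩ := mem_image.1 hE
  obtain ⟨t', ht', e⟩ := mem_image.1 hE'
  rw [coarc_injective e] at ht'
  exact Finset.disjoint_left.1 h ht ht'

/-- `Λ univ ≤ 1`. -/
theorem lam_univ_le_one : lam p (univ : Finset (Fin (3 * k + 2))) ≤ 1 := by
  classical
  rw [← famIn_coarcs_eq_lam]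
  exact famIn_le_one p univ _ _

/-- Shifting the origin of an interval: `ivl t (a+lo) (a+hi) = ivl (sh t a) lo hi` when `a + hi < 3k+2`. -/
theorem ivl_shift' (t : Fin (3 * k + 2)) {a lo hi : ℕ} (h : a + hi < 3 * k + 2) :
    ivl t (a + lo) (a + hi) = ivl (sh t a) lo hi := by
  ext x
  rw [mem_ivl, mem_ivl]
  have ea : fd t (sh t a) = a := fd_sh t (by omega)
  constructor
  · rintro ⟨h1, h2⟩
    rw [fd_sub (show fd t (sh t a) ≤ fd t x by rw [ea]; omega), ea]
    omega
  · rintro ⟨h1, h2⟩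
    have hsum : fd t (sh t a) + fd (sh t a) x < 3 * k + 2 := by rw [ea]; omega
    have := fd_add_fd hsum
    rw [ea] at this
    omega

/-- Points of the run after a change `t` have the colour of `sh t 1`. -/
theorem colour_of_mem_ivl {K : ℕ} (c : Fin (3 * k + 2) → Fin K) (t : Fin (3 * k + 2)) {x : Fin (3 * k + 2)}
    (hx : x ∈ ivl t 1 (nxt c t)) : c x = c (sh t 1) := by
  rw [mem_ivl] at hx
  rw [← sh_fd t x]
  exact colour_stretch c t hx.1 hx.2

/-- `zset` is symmetric. -/
theorem zset_comm (X Y : Finset (Fin (3 * k + 2))) : zset p X Y = zset p Y X := by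
  unfold zset
  refine sum_congr ?_ fun _ _ => rfl
  ext ω; simp only [mem_filter, mem_univ, true_and, union_comm X Y]
  constructor <;> rintro ⟨h1, h2, h3⟩ <;> exact ⟨h1, h3, h2⟩

/-- Comparing two products over `Fin K` that differ in two factors only. -/
theorem prod_le_prod_of_pair {K : ℕ} {f g : Fin K → ℝ} (i j : Fin K) (hij : i ≠ j) (hg : ∀ l, 0 ≤ g l)
    (hfg : ∀ l, l ≠ i → l ≠ j → f l = g l) (h2 : f i * f j ≤ g i * g j) : ∏ l, f l ≤ ∏ l, g l := by
  classical
  have hi : i ∈ (univ : Finset (Fin K)) := mem_univ i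
  have hj : j ∈ (univ : Finset (Fin K)).erase i := mem_erase.2 ⟨hij.symm, mem_univ j⟩
  rw [← mul_prod_erase _ f hi, ← mul_prod_erase _ f hj, ← mul_prod_erase _ g hi, ← mul_prod_erase _ g hj, ← mul_assoc,
    ← mul_assoc]
  have hrest : ∏ l ∈ ((univ : Finset (Fin K)).erase i).erase j, f l = ∏ l ∈ ((univ : Finset (Fin K)).erase i).erase j, g l := by
    refine prod_congr rfl fun l hl => ?_
    rw [mem_erase, mem_erase] at hl
    exact hfg l hl.2.1 hl.1
  rw [hrest]
  exact mul_le_mul_of_nonneg_right h2 (prod_nonneg fun l _ => hg l)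

/-- BASE CASE: at most two colours occur. [this work] -/
theorem colouring_ineq_two {K : ℕ} (c : Fin (3 * k + 2) → Fin K) (i j : Fin K)
    (h : ∀ x, c x = i ∨ c x = j) : ∏ l, lam p (cls c l) ≤ lam p ∅ ^ (K - 1) := by
  classical
  have ha := lam_nonneg (k := k) p ∅
  have hempty : ∀ l, l ≠ i → l ≠ j → cls c l = ∅ := by
    intro l hli hlj
    rw [cls, Finset.filter_eq_empty_iff]
    intro x _ hx
    rcases h x with h' | h' <;> [exact hli (hx.symm.trans h'); exact hlj (hx.symm.trans h')]
  have hi : i ∈ (univ : Finset (Fin K)) := mem_univ i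
  by_cases hij : i = j
  · -- one colour: the class of `i` is everything
    subst hij
    rw [← mul_prod_erase _ _ hi]
    have hcongr : ∀ l ∈ (univ : Finset (Fin K)).erase i, lam p (cls c l) = lam p ∅ := by
      intro l hl; rw [hempty l (ne_of_mem_erase hl) (ne_of_mem_erase hl)]
    have hrest : ∏ l ∈ (univ : Finset (Fin K)).erase i, lam p (cls c l) = lam p ∅ ^ (K - 1) := by
      rw [prod_congr rfl hcongr, prod_const, card_erase_of_mem hi, card_univ, Fintype.card_fin]
    rw [hrest]
    calc lam p (cls c i) * lam p ∅ ^ (K - 1) ≤ 1 * lam p ∅ ^ (K - 1) :=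
          mul_le_mul_of_nonneg_right ((lam_mono p (subset_univ _)).trans (lam_univ_le_one p)) (pow_nonneg ha _)
      _ = lam p ∅ ^ (K - 1) := one_mul _
  · have hj : j ∈ (univ : Finset (Fin K)).erase i := mem_erase.2 ⟨Ne.symm hij, mem_univ j⟩
    have hK2 : 2 ≤ K := by
      have := Fintype.card_le_of_injective (fun b : Bool => if b then i else j) (by
        intro b b' hb; cases b <;> cases b' <;> simp_all)
      simpa using this
    rw [← mul_prod_erase _ _ hi, ← mul_prod_erase _ _ hj, ← mul_assoc]
    have hcongr : ∀ l ∈ ((univ : Finset (Fin K)).erase i).erase j, lam p (cls c l) = lam p ∅ := by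
      intro l hl; rw [mem_erase, mem_erase] at hl; rw [hempty l hl.2.1 hl.1]
    have hrest : ∏ l ∈ ((univ : Finset (Fin K)).erase i).erase j, lam p (cls c l) = lam p ∅ ^ (K - 2) := by
      rw [prod_congr rfl hcongr, prod_const, card_erase_of_mem hj, card_erase_of_mem hi, card_univ, Fintype.card_fin]
      rfl
    rw [hrest]
    have hdisj : Disjoint (cls c i) (cls c j) := by
      rw [Finset.disjoint_left]; intro x hx hx'
      rw [cls, mem_filter] at hx hx'
      exact hij (hx.2.symm.trans hx'.2)
    calc lam p (cls c i) * lam p (cls c j) * lam p ∅ ^ (K - 2) ≤ lam p ∅ * lam p ∅ ^ (K - 2) :=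
          mul_le_mul_of_nonneg_right (lam_mul_le p hdisj) (pow_nonneg ha _)
      _ = lam p ∅ ^ (K - 1) := by rw [← pow_succ']; congr 1; omega

/-- Three colours fail to occur: at most two do. -/
theorem two_colours_of_not_three {K : ℕ} (c : Fin (3 * k + 2) → Fin K)
    (h : ¬ ∃ u v w, c u ≠ c v ∧ c v ≠ c w ∧ c u ≠ c w) : ∃ i j, ∀ x, c x = i ∨ c x = j := by
  by_cases h1 : ∀ x, c x = c 0
  · exact ⟨c 0, c 0, fun x => Or.inl (h1 x)⟩
  · push Not at h1
    obtain ⟨v, hv⟩ := h1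
    refine ⟨c 0, c v, fun x => ?_⟩
    by_contra hx
    push Not at hx
    exact h ⟨0, v, x, fun e => hv e.symm, fun e => hx.2 e.symm, fun e => hx.1 e.symm⟩

/-! ### The recolouring step -/

/-- The recoloured colouring: points of `X` get colour `j`. -/
def recol {K : ℕ} (c : Fin (3 * k + 2) → Fin K) (X : Finset (Fin (3 * k + 2))) (j : Fin K) : Fin (3 * k + 2) → Fin K :=
  fun x => if x ∈ X then j else c x

/-- Classes of the recoloured colouring. -/
theorem cls_recol {K : ℕ} (c : Fin (3 * k + 2) → Fin K) (X : Finset (Fin (3 * k + 2))) (i j l : Fin K)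
    (hX : X ⊆ cls c i) :
    cls (recol c X j) l = if l = j then cls c j ∪ X else if l = i then cls c i \ X else cls c l := by
  classical
  ext x
  have hXi : x ∈ X → c x = i := fun hx => by have := hX hx; rw [cls, mem_filter] at this; exact this.2
  simp only [cls, recol, mem_filter, mem_univ, true_and]
  by_cases h1 : x ∈ X
  · rw [if_pos h1]
    by_cases h2 : l = j
    · rw [if_pos h2, mem_union]; exact ⟨fun _ => Or.inr h1, fun _ => h2.symm⟩
    · rw [if_neg h2]
      by_cases h3 : l = i
      · rw [if_pos h3, mem_sdiff]; exact ⟨fun h => absurd h.symm h2, fun h => absurd h1 h.2⟩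
      · rw [if_neg h3, mem_filter]
        exact ⟨fun h => absurd h.symm h2, fun h => absurd ((hXi h1).symm.trans h.2) (Ne.symm h3)⟩
  · rw [if_neg h1]
    by_cases h2 : l = j
    · rw [if_pos h2, mem_union, mem_filter]; subst h2
      exact ⟨fun h => Or.inl ⟨mem_univ _, h⟩, fun h => h.elim (fun h => h.2) fun h => absurd h h1⟩
    · rw [if_neg h2]
      by_cases h3 : l = i
      · rw [if_pos h3, mem_sdiff, mem_filter]; subst h3
        exact ⟨fun h => ⟨⟨mem_univ _, h⟩, h1⟩, fun h => h.1.2⟩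
      · rw [if_neg h3, mem_filter]
        exact ⟨fun h => ⟨mem_univ _, h⟩, fun h => h.2⟩

/-- Recolouring the run after a change `t` either to the colour of the following run or to the colour of `t` removes one
colour change (at the end, resp. at the beginning of the run) and creates none: the number of colour changes drops. [this work] -/
theorem card_changes_recol_lt {K : ℕ} (c : Fin (3 * k + 2) → Fin K) {t : Fin (3 * k + 2)} (ht : IsChange c t)
    (h2 : ∃ u v, c u ≠ c v) (j : Fin K) (hj : j = c (sh t (nxt c t + 1)) ∨ j = c t) :
    (univ.filter (IsChange (recol c (ivl t 1 (nxt c t)) j))).card < (univ.filter (IsChange c)).card := by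
  classical
  set l1 := nxt c t with hl1
  have hl1N : l1 < 3 * k + 2 := nxt_lt c h2 t
  have hl1p : 1 ≤ l1 := one_le_nxt c t
  set t' := sh t l1 with ht'
  have ht'c : IsChange c t' := isChange_sh_nxt c ht
  have hN1 : 1 < 3 * k + 2 := by omega
  -- the successor of a point, in coordinates from `t`
  have hsucc : ∀ x : Fin (3 * k + 2), fd t x + 1 < 3 * k + 2 → fd t (sh x 1) = fd t x + 1 := by
    intro x hx
    have := @fd_add_fd _ _ t x (sh x 1) (by rw [fd_sh x hN1]; exact hx)
    rw [fd_sh x hN1] at this; omega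
  have hlast : ∀ x : Fin (3 * k + 2), fd t x = 3 * k + 1 → sh x 1 = t := by
    intro x hx; rw [← sh_fd t x, sh_sh, hx]; exact sh_n t
  have e1 : fd t t' = l1 := by rw [ht', fd_sh t hl1N]
  have ht'mem : t' ∈ ivl t 1 l1 := by rw [mem_ivl, e1]; exact ⟨hl1p, le_rfl⟩
  have ht'succ : sh t' 1 ∉ ivl t 1 l1 := by
    rw [mem_ivl]
    by_cases hlt : l1 + 1 < 3 * k + 2
    · rw [hsucc t' (by rw [e1]; exact hlt), e1]; omega
    · rw [hlast t' (by omega), fd_self]; omega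
  have htmem : t ∉ ivl t 1 l1 := by rw [mem_ivl, fd_self]; omega
  have htsucc : sh t 1 ∈ ivl t 1 l1 := by rw [mem_ivl, fd_sh t hN1]; exact ⟨le_rfl, hl1p⟩
  -- changes of the recoloured colouring are changes of `c`, and `t`, `t'` are changes only in the expected way
  have core : ∀ x, IsChange (recol c (ivl t 1 l1) j) x →
      IsChange c x ∧ (x = t' → j ≠ c (sh t' 1)) ∧ (x = t → c t ≠ j) := by
    intro x hx
    unfold IsChange recol at hx
    by_cases hxX : x ∈ ivl t 1 l1 <;> by_cases hx1 : sh x 1 ∈ ivl t 1 l1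
    · rw [if_pos hxX, if_pos hx1] at hx; exact absurd rfl hx
    · -- `x` is the last point of the run: `x = t'`
      rw [if_pos hxX, if_neg hx1] at hx
      have hxX' := mem_ivl.1 hxX; have hx1' := hx1; rw [mem_ivl] at hx1'
      have hfx : fd t x = l1 := by
        by_contra hne
        have h1 : fd t x + 1 < 3 * k + 2 := by omega
        have := hsucc x h1; omega
      have hxt' : x = t' := by rw [ht', ← hfx, sh_fd]
      subst hxt'
      refine ⟨ht'c, fun _ => hx, fun h => ?_⟩
      rw [h] at hxX; exact absurd hxX htmem
    · -- `sh x 1` is the first point of the run: `x = t`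
      rw [if_neg hxX, if_pos hx1] at hx
      have hxX' := hxX; rw [mem_ivl] at hxX'
      have hx1' := mem_ivl.1 hx1
      have hfx : fd t x = 0 := by
        by_contra hne
        by_cases hlt : fd t x + 1 < 3 * k + 2
        · have := hsucc x hlt; omega
        · have := hlast x (by have := fd_lt t x; omega)
          rw [this, fd_self] at hx1'; omega
      rw [fd_eq_zero_iff] at hfx
      subst hfx
      refine ⟨ht, fun h => ?_, fun _ => hx⟩
      rw [← h] at ht'mem; exact absurd ht'mem hxX
    · rw [if_neg hxX, if_neg hx1] at hx
      refine ⟨hx, fun h => ?_, fun h => ?_⟩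
      · rw [h] at hxX; exact absurd ht'mem hxX
      · rw [h] at hx1; exact absurd htsucc hx1
  refine card_lt_card ⟨fun x hx => ?_, ?_⟩
  · rw [mem_filter] at hx ⊢
    exact ⟨mem_univ _, (core x hx.2).1⟩
  · rw [not_subset]
    rcases hj with hj | hj
    · -- `t'` is a change of `c` but not of the recoloured colouring
      refine ⟨t', mem_filter.2 ⟨mem_univ _, ht'c⟩, fun h => ?_⟩
      rw [mem_filter] at h
      have := (core t' h.2).2.1 rfl
      rw [hj, ht', sh_sh] at this
      exact this rfl
    · refine ⟨t, mem_filter.2 ⟨mem_univ _, ht⟩, fun h => ?_⟩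
      rw [mem_filter] at h
      exact (core t h.2).2.2 rfl hj.symm

end Main

end Arc

end SafeCalc

end Summit.CriticalPhenomena.PercolationContinuityZ3.Theorems.SunflowerPartition
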